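import Summits.ValiantsHypothesis.ValiantsHypothesis.Theses.IntegralOrbits
import Literature.Computability.AlgebraicComplexity.DeterminantalComplexityProofs
import Literature.Computability.AlgebraicComplexity.VPDeterminantalQPProofs
import Literature.Computability.AlgebraicComplexity.ValiantClasses
import Literature.Computability.AlgebraicComplexity.ValiantConjectureProofs

/-!
# `IntDetGlue` (item `stmt-ValiantsHypothesis-7682`, route `IntegralOrbits`)

Layer-1 glue of the route `IntegralOrbits` of the sub-problem `ValiantsHypothesis`:

  `RationalCharacterNF → IntegralCharacterLift → HeightToSize → IntDetQP`,

stated verbatim against the route decls (`intDetGlue_proof`). Pure bookkeeping: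

1. `exists_qp_hasDetRepr_per`: `VP ℂ = VNP ℂ` puts the permanent family in `VP`
   (`perFamily_mem_VNP_holds`, renaming bridge `mem_VP_ofFintype_iff_holds`), hence `dc(per_n)` is
   quasi-polynomially bounded (`isQPBounded_determinantalComplexity_of_isVPFamily_holds`,
   Bürgisser–Clausen–Shokrollahi 1997, Cor. (21.40)) and attained
   (`hasDetRepr_determinantalComplexity_holds`). All four cone facts are discharged theorems.
2. `RationalCharacterNF` normalises the expression to `det (1 + Σ_v (x_v − δ_v) M_v) = per_n`;
   `IntegralCharacterLift` (at `ι = Fin n × Fin n`) gives integer matrices `Z_v` of size `m'²` with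
   the generic pencil identity `det (X₀·1 + Σ_v X_v Z_v/N^e) = det (X₀·1 + Σ_v X_v M_v)^r`.
3. `det_subst_pencil`: substitute `X₀ ↦ 1`, `X_v ↦ x_v − δ_v` (`MvPolynomial.aeval`, determinants
   commute with ring maps, `AlgHom.map_det`), so `det (1 + Σ_v (x_v − δ_v) Z_v/N^e) = per_n^r`.
4. `det_intModel`: the integer model `B = N^e·1 + Σ_v (x_v − δ_v) Z_v` over `ℤ` maps
   coefficientwise to `N^e` times the substituted pencil (`mapMatrix_intModel`), so
   `det B = N^(e m'²) · per_n^r` by `Matrix.det_smul`, `map_perPoly` and injectivity of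
   `MvPolynomial.map (Int.castRingHom ℂ)`; its entries are affine (`totalDegree_intModel_le`) of
   height `≤ N^e + n²·2·2^K ≤ 2^(h e + K + n² + 2)` (`abs_coeff_intModel_le`, `height_bound`).
5. Reindex `Fin m' × Fin m' ≃ Fin (m'·m')` (`Matrix.det_reindex_self`), compress heights with
   `HeightToSize`, and compose the quasi-polynomial bounds (`final_bound`, elementary arithmetic
   with levels `2^(u^i)`, `u = log₂ n + C`, `C = (c₁+2)c₂ + c₁ + c₂ + c₃ + c₄ + 8`).

The output is `d = r ≥ 1`, `N' = N^(e m'²) ≠ 0`, and the `{−1,0,1}`-matrix from `HeightToSize`.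
-/

set_option linter.dupNamespace false -- single-conjunct summit: `ValiantsHypothesis.ValiantsHypothesis`

namespace Summit.ValiantsHypothesis.ValiantsHypothesis.Theorems.IntegralOrbitsIntDetGlue

open Literature.Computability.AlgebraicComplexity MvPolynomial

/-- Step 1: `VP ℂ = VNP ℂ` gives quasi-polynomially bounded affine determinantal representations
of the permanents (cone facts, all discharged). [folklore] -/
theorem exists_qp_hasDetRepr_per
    (hEq : Literature.Computability.AlgebraicComplexity.VP ℂ =
      Literature.Computability.AlgebraicComplexity.VNP ℂ) :
    ∃ c : ℕ, ∀ n : ℕ, ∃ m : ℕ, m ≤ 2 ^ ((Nat.log 2 n + c) ^ c) ∧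
      HasDetRepr (perPoly (Fin n) ℂ) m := by
  have hper : perFamily ℂ ∈ Literature.Computability.AlgebraicComplexity.VP ℂ := by
    rw [hEq]; exact perFamily_mem_VNP_holds ℂ
  have hVP : IsVPFamily (fun n => perPoly (Fin n) ℂ) := (mem_VP_ofFintype_iff_holds _).1 hper
  obtain ⟨c, hc⟩ := isQPBounded_determinantalComplexity_of_isVPFamily_holds _ hVP
  exact ⟨c, fun n => ⟨_, hc n, hasDetRepr_determinantalComplexity_holds _⟩⟩

section Subst

/-- Rewriting the scaled integer matrices of the lift as `C`-images of complex matrices. [folklore] -/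
theorem map_C_div_eq {ι p : Type*} (Zv : Matrix p p ℤ) (N e : ℕ) :
    Zv.map (fun z : ℤ => (C ((z : ℂ) / (N : ℂ) ^ e) : MvPolynomial (Option ι) ℂ)) =
      (Zv.map (fun z : ℤ => (z : ℂ) / (N : ℂ) ^ e)).map (C : ℂ →+* MvPolynomial (Option ι) ℂ) := by
  rw [Matrix.map_map]; rfl

variable {ι : Type*} [Fintype ι] {p : Type*} [Fintype p] [DecidableEq p]

/-- The substitution `X₀ ↦ 1, X_v ↦ g v` applied entrywise to a generic pencil
`X₀·1 + Σ_v X_v W_v`. [folklore] -/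
theorem mapMatrix_aeval_pencil {τ : Type*} (g : ι → MvPolynomial τ ℂ) (W : ι → Matrix p p ℂ) :
    (aeval (fun o : Option ι => Option.elim o (1 : MvPolynomial τ ℂ) g)).mapMatrix
      ((X none : MvPolynomial (Option ι) ℂ) • (1 : Matrix p p (MvPolynomial (Option ι) ℂ)) +
        ∑ v : ι, (X (some v) : MvPolynomial (Option ι) ℂ) •
          (W v).map (C : ℂ →+* MvPolynomial (Option ι) ℂ)) =
      (1 : Matrix p p (MvPolynomial τ ℂ)) + ∑ v : ι, g v • (W v).map (C : ℂ →+* MvPolynomial τ ℂ) := by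
  ext a b
  simp only [AlgHom.mapMatrix_apply, Matrix.map_apply, Matrix.add_apply, Matrix.smul_apply,
    Matrix.sum_apply, Matrix.one_apply, smul_eq_mul, map_add, map_mul, map_sum, aeval_X,
    Option.elim, algHom_C, algebraMap_eq]
  congr 1
  split_ifs <;> simp

/-- Determinants commute with the substitution: a pencil identity `det P(W₁) = det P(W₂)^r`
specialises to the substituted matrices. [folklore] -/
theorem det_subst_pencil {q : Type*} [Fintype q] [DecidableEq q] {τ : Type*}
    (g : ι → MvPolynomial τ ℂ) (W₁ : ι → Matrix p p ℂ) (W₂ : ι → Matrix q q ℂ) (r : ℕ)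
    (h : ((X none : MvPolynomial (Option ι) ℂ) • (1 : Matrix p p (MvPolynomial (Option ι) ℂ)) +
        ∑ v : ι, (X (some v) : MvPolynomial (Option ι) ℂ) •
          (W₁ v).map (C : ℂ →+* MvPolynomial (Option ι) ℂ)).det =
      (((X none : MvPolynomial (Option ι) ℂ) • (1 : Matrix q q (MvPolynomial (Option ι) ℂ)) +
        ∑ v : ι, (X (some v) : MvPolynomial (Option ι) ℂ) •
          (W₂ v).map (C : ℂ →+* MvPolynomial (Option ι) ℂ)).det) ^ r) :
    ((1 : Matrix p p (MvPolynomial τ ℂ)) +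
        ∑ v : ι, g v • (W₁ v).map (C : ℂ →+* MvPolynomial τ ℂ)).det =
      (((1 : Matrix q q (MvPolynomial τ ℂ)) +
        ∑ v : ι, g v • (W₂ v).map (C : ℂ →+* MvPolynomial τ ℂ)).det) ^ r := by
  have := congrArg (aeval (fun o : Option ι => Option.elim o (1 : MvPolynomial τ ℂ) g)) h
  rwa [map_pow, AlgHom.map_det, AlgHom.map_det, mapMatrix_aeval_pencil,
    mapMatrix_aeval_pencil] at this

end Subst

section IntModel

variable {ι : Type*} [Fintype ι] {p : Type*} [Fintype p] [DecidableEq p]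

/-- The integer model `N^e·1 + Σ_v (X_v − δ_v) Z_v` maps, coefficientwise along `ℤ → ℂ`, to
`N^e` times the substituted scaled pencil `1 + Σ_v (X_v − δ_v) Z_v / N^e`. [folklore] -/
theorem mapMatrix_intModel (δℤ : ι → ℤ) (δ : ι → ℂ) (hδ : ∀ v, ((δℤ v : ℤ) : ℂ) = δ v)
    (Z : ι → Matrix p p ℤ) (N e : ℕ) (hN : (N : ℂ) ≠ 0) :
    (MvPolynomial.map (Int.castRingHom ℂ)).mapMatrix
      ((C ((N : ℤ) ^ e) : MvPolynomial ι ℤ) • (1 : Matrix p p (MvPolynomial ι ℤ)) +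
        ∑ v : ι, ((X v : MvPolynomial ι ℤ) - C (δℤ v)) • (Z v).map (C : ℤ →+* MvPolynomial ι ℤ)) =
    (C ((N : ℂ) ^ e) : MvPolynomial ι ℂ) • ((1 : Matrix p p (MvPolynomial ι ℂ)) +
      ∑ v : ι, ((X v : MvPolynomial ι ℂ) - C (δ v)) •
        ((Z v).map (fun z : ℤ => (z : ℂ) / (N : ℂ) ^ e)).map (C : ℂ →+* MvPolynomial ι ℂ)) := by
  ext a b
  have key : ∀ v : ι, (C ((N : ℂ) ^ e) : MvPolynomial ι ℂ) *
      (((X v : MvPolynomial ι ℂ) - C (δ v)) * C (((Z v a b : ℤ) : ℂ) / (N : ℂ) ^ e)) =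
      ((X v : MvPolynomial ι ℂ) - C (δ v)) * C ((Z v a b : ℤ) : ℂ) := by
    intro v
    rw [mul_left_comm, ← map_mul, mul_div_cancel₀ _ (pow_ne_zero e hN)]
  simp only [RingHom.mapMatrix_apply, Matrix.map_apply, Matrix.add_apply, Matrix.smul_apply,
    Matrix.sum_apply, Matrix.one_apply, smul_eq_mul, map_add, map_sum, map_mul, map_sub, map_X,
    map_C, Int.coe_castRingHom, Int.cast_pow, Int.cast_natCast, hδ,
    apply_ite (MvPolynomial.map (Int.castRingHom ℂ)), map_one, map_zero, mul_add,
    Finset.mul_sum, key]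

/-- Determinant of the integer model: `det (N^e·1 + Σ_v (X_v − δ_v) Z_v) = N^{e·#p} · P^r`
whenever the substituted scaled pencil has determinant `P^r` over `ℂ` (descent along the
injection `MvPolynomial ι ℤ → MvPolynomial ι ℂ`). [folklore] -/
theorem det_intModel (δℤ : ι → ℤ) (δ : ι → ℂ) (hδ : ∀ v, ((δℤ v : ℤ) : ℂ) = δ v)
    (Z : ι → Matrix p p ℤ) (N e r : ℕ) (hN : (N : ℂ) ≠ 0) (P : MvPolynomial ι ℤ)
    (hQ : ((1 : Matrix p p (MvPolynomial ι ℂ)) + ∑ v : ι, ((X v : MvPolynomial ι ℂ) - C (δ v)) •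
        ((Z v).map (fun z : ℤ => (z : ℂ) / (N : ℂ) ^ e)).map (C : ℂ →+* MvPolynomial ι ℂ)).det =
      (MvPolynomial.map (Int.castRingHom ℂ) P) ^ r) :
    ((C ((N : ℤ) ^ e) : MvPolynomial ι ℤ) • (1 : Matrix p p (MvPolynomial ι ℤ)) +
        ∑ v : ι, ((X v : MvPolynomial ι ℤ) - C (δℤ v)) •
          (Z v).map (C : ℤ →+* MvPolynomial ι ℤ)).det = C ((N : ℤ) ^ (e * Fintype.card p)) * P ^ r := by
  apply MvPolynomial.map_injective (Int.castRingHom ℂ) Int.cast_injective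
  rw [RingHom.map_det, mapMatrix_intModel δℤ δ hδ Z N e hN, Matrix.det_smul, hQ,
    map_mul (MvPolynomial.map (Int.castRingHom ℂ)),
    map_pow (MvPolynomial.map (Int.castRingHom ℂ)) P r, map_C, ← C_pow, ← pow_mul]
  congr 2
  simp

omit [Fintype p] in
/-- Entries of the integer model. [folklore] -/
theorem intModel_apply (δℤ : ι → ℤ) (Z : ι → Matrix p p ℤ) (c : ℤ) (a b : p) :
    ((C c : MvPolynomial ι ℤ) • (1 : Matrix p p (MvPolynomial ι ℤ)) +
        ∑ v : ι, ((X v : MvPolynomial ι ℤ) - C (δℤ v)) • (Z v).map (C : ℤ →+* MvPolynomial ι ℤ)) a b =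
      (if a = b then (C c : MvPolynomial ι ℤ) else 0) +
        ∑ v : ι, ((X v : MvPolynomial ι ℤ) - C (δℤ v)) * C (Z v a b) := by
  simp only [Matrix.add_apply, Matrix.smul_apply, Matrix.sum_apply, Matrix.one_apply,
    Matrix.map_apply, smul_eq_mul, mul_ite, mul_one, mul_zero]

omit [Fintype p] in
/-- The integer model has affine entries. [folklore] -/
theorem totalDegree_intModel_le (δℤ : ι → ℤ) (Z : ι → Matrix p p ℤ) (c : ℤ) (a b : p) :
    (((C c : MvPolynomial ι ℤ) • (1 : Matrix p p (MvPolynomial ι ℤ)) +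
        ∑ v : ι, ((X v : MvPolynomial ι ℤ) - C (δℤ v)) •
          (Z v).map (C : ℤ →+* MvPolynomial ι ℤ)) a b).totalDegree ≤ 1 := by
  rw [intModel_apply]
  refine (totalDegree_add _ _).trans (max_le ?_ ?_)
  · split_ifs
    · exact (totalDegree_C _).trans_le zero_le_one
    · exact totalDegree_zero.trans_le zero_le_one
  · refine totalDegree_finsetSum_le fun v _ => (totalDegree_mul _ _).trans ?_
    rw [totalDegree_C, add_zero]
    exact (totalDegree_sub_C_le _ _).trans (totalDegree_X _).le

omit [Fintype p] in
/-- Coefficient heights of the integer model. [folklore] -/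
theorem abs_coeff_intModel_le (δℤ : ι → ℤ) (hδ : ∀ v, |δℤ v| ≤ 1) (Z : ι → Matrix p p ℤ)
    (c : ℤ) (K : ℕ) (hZ : ∀ v a b, |Z v a b| ≤ 2 ^ K) (a b : p) (s : ι →₀ ℕ) :
    |coeff s (((C c : MvPolynomial ι ℤ) • (1 : Matrix p p (MvPolynomial ι ℤ)) +
        ∑ v : ι, ((X v : MvPolynomial ι ℤ) - C (δℤ v)) •
          (Z v).map (C : ℤ →+* MvPolynomial ι ℤ)) a b)| ≤ |c| + Fintype.card ι * (2 * 2 ^ K) := by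
  classical
  rw [intModel_apply, coeff_add, coeff_sum]
  refine (abs_add_le _ _).trans (add_le_add ?_ ?_)
  · split_ifs
    · rw [coeff_C]
      split_ifs <;> simp
    · simp
  · refine (Finset.abs_sum_le_sum_abs _ _).trans ?_
    have hterm : ∀ v ∈ (Finset.univ : Finset ι),
        |coeff s (((X v : MvPolynomial ι ℤ) - C (δℤ v)) * C (Z v a b))| ≤ 2 * 2 ^ K := by
      intro v _
      rw [mul_comm, coeff_C_mul, abs_mul, coeff_sub, coeff_X, coeff_C]
      have h1 : |(if Finsupp.single v 1 = s then (1 : ℤ) else 0)| ≤ 1 := by split_ifs <;> simp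
      have h2 : |(if (0 : ι →₀ ℕ) = s then δℤ v else 0)| ≤ 1 := by
        split_ifs
        · exact hδ v
        · simp
      have h12 : |(if Finsupp.single v 1 = s then (1 : ℤ) else 0) -
          (if (0 : ι →₀ ℕ) = s then δℤ v else 0)| ≤ 2 := (abs_sub _ _).trans (by linarith)
      exact (mul_le_mul (hZ v a b) h12 (abs_nonneg _) (by positivity)).trans_eq (mul_comm _ _)
    refine (Finset.sum_le_sum hterm).trans ?_
    rw [Finset.sum_const, Finset.card_univ, nsmul_eq_mul]

end IntModel

section Arith

/-- Elementary height bookkeeping: `N^e + k·2·2^K ≤ 2^(h e + K + k + 2)` for `N ≤ 2^h`. [folklore] -/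
theorem height_bound (N h e K k : ℕ) (hN : N ≤ 2 ^ h) :
    N ^ e + k * (2 * 2 ^ K) ≤ 2 ^ (h * e + K + k + 2) := by
  have h1 : N ^ e ≤ 2 ^ (h * e) := by rw [pow_mul]; exact Nat.pow_le_pow_left hN e
  have h3 : k * (2 * 2 ^ K) ≤ 2 ^ (k + K + 1) := by
    calc k * (2 * 2 ^ K) ≤ 2 ^ k * (2 * 2 ^ K) :=
          Nat.mul_le_mul_right _ (Nat.lt_two_pow_self (n := k)).le
      _ = 2 ^ (k + K + 1) := by ring
  calc N ^ e + k * (2 * 2 ^ K) ≤ 2 ^ (h * e) + 2 ^ (k + K + 1) := add_le_add h1 h3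
    _ ≤ 2 ^ (h * e + K + k + 1) + 2 ^ (h * e + K + k + 1) :=
        add_le_add (Nat.pow_le_pow_right (by norm_num) (by omega))
          (Nat.pow_le_pow_right (by norm_num) (by omega))
    _ = 2 ^ (h * e + K + k + 2) := by ring

/-- Levels `2^(u^i)` are monotone in `i`. [folklore] -/
theorem level_mono (u i j : ℕ) (hu : 1 ≤ u) (hij : i ≤ j) : 2 ^ u ^ i ≤ 2 ^ u ^ j :=
  Nat.pow_le_pow_right (by norm_num) (Nat.pow_le_pow_right hu hij)

/-- Four quantities of level `i` sum to a quantity of level `i + 1` (`u ≥ 4`). [folklore] -/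
theorem sum4_le (u i a b c d : ℕ) (hu : 4 ≤ u) (ha : a ≤ 2 ^ u ^ i) (hb : b ≤ 2 ^ u ^ i)
    (hc : c ≤ 2 ^ u ^ i) (hd : d ≤ 2 ^ u ^ i) : a + b + c + d ≤ 2 ^ u ^ (i + 1) := by
  have h1 : a + b + c + d ≤ 2 ^ (u ^ i + 2) := by
    calc a + b + c + d ≤ 2 ^ u ^ i + 2 ^ u ^ i + 2 ^ u ^ i + 2 ^ u ^ i := by omega
      _ = 2 ^ (u ^ i + 2) := by ring
  refine h1.trans (Nat.pow_le_pow_right (by norm_num) ?_)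
  have h2 : 1 ≤ u ^ i := Nat.one_le_pow _ _ (by omega)
  calc u ^ i + 2 ≤ u ^ i + 3 * u ^ i := by omega
    _ = u ^ i * 4 := by ring
    _ ≤ u ^ i * u := Nat.mul_le_mul_left _ hu
    _ = u ^ (i + 1) := (pow_succ u i).symm

/-- The product of two quantities of level `i` has level `i + 1` (`u ≥ 2`). [folklore] -/
theorem mul_le_level (u i a b : ℕ) (hu : 2 ≤ u) (ha : a ≤ 2 ^ u ^ i) (hb : b ≤ 2 ^ u ^ i) :
    a * b ≤ 2 ^ u ^ (i + 1) := by
  calc a * b ≤ 2 ^ u ^ i * 2 ^ u ^ i := Nat.mul_le_mul ha hb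
    _ = 2 ^ (u ^ i * 2) := by ring
    _ ≤ 2 ^ u ^ (i + 1) := by
        refine Nat.pow_le_pow_right (by norm_num) ?_
        rw [pow_succ]
        exact Nat.mul_le_mul_left _ hu

/-- A `c`-th power (`c ≤ u`) of a quantity of level `i` has level `i + 1`. [folklore] -/
theorem pow_le_level (u i a c : ℕ) (hc : c ≤ u) (ha : a ≤ 2 ^ u ^ i) :
    a ^ c ≤ 2 ^ u ^ (i + 1) := by
  calc a ^ c ≤ (2 ^ u ^ i) ^ c := Nat.pow_le_pow_left ha c
    _ = 2 ^ (u ^ i * c) := by rw [← pow_mul]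
    _ ≤ 2 ^ u ^ (i + 1) := by
        refine Nat.pow_le_pow_right (by norm_num) ?_
        rw [pow_succ]
        exact Nat.mul_le_mul_left _ hc

/-- The quasi-polynomial bookkeeping of the glue (pure arithmetic): composing the four bounds
(`VP ⟹ dc qp`, normal form, lift, height compression) stays quasi-polynomial in `n`. [folklore] -/
theorem final_bound (c₁ c₂ c₃ c₄ n m m' h e m'' : ℕ)
    (hm : m ≤ 2 ^ ((Nat.log 2 n + c₁) ^ c₁))
    (hm' : m' ≤ 2 ^ ((Nat.log 2 m + c₂) ^ c₂)) (hh : h ≤ 2 ^ ((Nat.log 2 m + c₂) ^ c₂))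
    (he : e ≤ (m' + n * n + h + 2) ^ c₃)
    (hm'' : m'' ≤
      (m' * m' + n * n + (h * e + (m' + n * n + h + 2) ^ c₃ + n * n + 2) + 2) ^ c₄) :
    m'' ≤ 2 ^ ((Nat.log 2 n + ((c₁ + 2) * c₂ + c₁ + c₂ + c₃ + c₄ + 8)) ^
      ((c₁ + 2) * c₂ + c₁ + c₂ + c₃ + c₄ + 8)) := by
  set C := (c₁ + 2) * c₂ + c₁ + c₂ + c₃ + c₄ + 8 with hC
  set u := Nat.log 2 n + C with hu
  set P := (c₁ + 2) * c₂ + 2 with hP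
  have hu4 : 4 ≤ u := by omega
  have hu2 : 2 ≤ u := by omega
  have hu1 : 1 ≤ u := by omega
  have hE₁ : (Nat.log 2 n + c₁) ^ c₁ ≤ u ^ c₁ := Nat.pow_le_pow_left (by omega) _
  have hlogm : Nat.log 2 m ≤ u ^ c₁ := by
    have h1 := Nat.log_mono_right (b := 2) hm
    rw [Nat.log_pow (by norm_num)] at h1
    exact h1.trans hE₁
  have hE₂ : (Nat.log 2 m + c₂) ^ c₂ ≤ u ^ P := by
    have h1 : Nat.log 2 m + c₂ ≤ u ^ (c₁ + 2) := by
      have h2 : u ^ c₁ ≤ u ^ (c₁ + 1) := Nat.pow_le_pow_right hu1 (by omega)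
      have h3 : u ≤ u ^ (c₁ + 1) := by
        calc u = u ^ 1 := (pow_one u).symm
          _ ≤ u ^ (c₁ + 1) := Nat.pow_le_pow_right hu1 (by omega)
      have h4 : u ^ (c₁ + 1) * 2 ≤ u ^ (c₁ + 2) := by
        rw [pow_succ u (c₁ + 1)]
        exact Nat.mul_le_mul_left _ hu2
      have h5 : c₂ ≤ u := by omega
      omega
    calc (Nat.log 2 m + c₂) ^ c₂ ≤ (u ^ (c₁ + 2)) ^ c₂ := Nat.pow_le_pow_left h1 _
      _ = u ^ ((c₁ + 2) * c₂) := by rw [← pow_mul]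
      _ ≤ u ^ P := Nat.pow_le_pow_right hu1 (by omega)
  have hm'P : m' ≤ 2 ^ u ^ P := hm'.trans (Nat.pow_le_pow_right (by norm_num) hE₂)
  have hhP : h ≤ 2 ^ u ^ P := hh.trans (Nat.pow_le_pow_right (by norm_num) hE₂)
  have hn : n ≤ 2 ^ u := by
    have h1 := Nat.lt_pow_succ_log_self (b := 2) (by norm_num) n
    exact h1.le.trans (Nat.pow_le_pow_right (by norm_num) (by omega))
  have hnnP : n * n ≤ 2 ^ u ^ P := by
    calc n * n ≤ 2 ^ u * 2 ^ u := Nat.mul_le_mul hn hn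
      _ = 2 ^ (u * 2) := by ring
      _ ≤ 2 ^ u ^ 2 := by
          refine Nat.pow_le_pow_right (by norm_num) ?_
          rw [sq]
          exact Nat.mul_le_mul_left _ hu2
      _ ≤ 2 ^ u ^ P := level_mono u 2 P hu1 (by omega)
  have h2P : ∀ i, 2 ≤ 2 ^ u ^ i := fun i =>
    calc 2 = 2 ^ 1 := (pow_one 2).symm
      _ ≤ 2 ^ u ^ i := Nat.pow_le_pow_right (by norm_num) (Nat.one_le_pow _ _ (by omega))
  have hS : m' + n * n + h + 2 ≤ 2 ^ u ^ (P + 1) :=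
    sum4_le u P _ _ _ _ hu4 hm'P hnnP hhP (h2P P)
  have hK : (m' + n * n + h + 2) ^ c₃ ≤ 2 ^ u ^ (P + 2) :=
    pow_le_level u (P + 1) _ c₃ (by omega) hS
  have heP : e ≤ 2 ^ u ^ (P + 2) := he.trans hK
  have hhe : h * e ≤ 2 ^ u ^ (P + 3) :=
    mul_le_level u (P + 2) h e hu2 (hhP.trans (level_mono u P (P + 2) hu1 (by omega))) heP
  have hh' : h * e + (m' + n * n + h + 2) ^ c₃ + n * n + 2 ≤ 2 ^ u ^ (P + 4) :=
    sum4_le u (P + 3) _ _ _ _ hu4 hhe (hK.trans (level_mono u _ _ hu1 (by omega)))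
      (hnnP.trans (level_mono u _ _ hu1 (by omega))) (h2P _)
  have hmm : m' * m' ≤ 2 ^ u ^ (P + 1) := mul_le_level u P _ _ hu2 hm'P hm'P
  have hS' : m' * m' + n * n + (h * e + (m' + n * n + h + 2) ^ c₃ + n * n + 2) + 2 ≤
      2 ^ u ^ (P + 5) :=
    sum4_le u (P + 4) _ _ _ _ hu4 (hmm.trans (level_mono u _ _ hu1 (by omega)))
      (hnnP.trans (level_mono u _ _ hu1 (by omega))) hh' (h2P _)
  have hfin : m'' ≤ 2 ^ u ^ (P + 6) := hm''.trans (pow_le_level u (P + 5) _ c₄ (by omega) hS')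
  exact hfin.trans (level_mono u _ _ hu1 (by omega))

end Arith

end IntegralOrbitsIntDetGlue

open Literature.Computability.AlgebraicComplexity MvPolynomial IntegralOrbitsIntDetGlue in
/-- **Settles `stmt-ValiantsHypothesis-7682`** (`IntegralOrbits.IntDetGlue`, stated verbatim):
the layer-1 glue `RationalCharacterNF → IntegralCharacterLift → HeightToSize → IntDetQP`.
From `VP ℂ = VNP ℂ` take a quasi-polynomial affine determinantal expression of `per_n`
(`exists_qp_hasDetRepr_per`), normalise it (`RationalCharacterNF`), lift the tuple to integer
matrices `Z_v` of size `m'²` (`IntegralCharacterLift` at `ι = Fin n × Fin n`), substitute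
`X₀ ↦ 1, X_v ↦ x_v − δ_v` (`det_subst_pencil`), clear `N^e` row-wise and descend to `ℤ`
(`det_intModel`: `det (N^e·1 + Σ_v (x_v − δ_v) Z_v) = N^(e m'²) per_n^r`), reindex to
`Fin (m'·m')`, bound degrees and heights (`totalDegree_intModel_le`, `abs_coeff_intModel_le`,
`height_bound`), compress heights to `{−1,0,1}` (`HeightToSize`) and compose the bounds
(`final_bound`), with `c = (c₁+2)c₂ + c₁ + c₂ + c₃ + c₄ + 8`, `n₀ = 0`, `d = r`, `N' = N^(e m'²)`.
[folklore] -/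
theorem intDetGlue_proof :
    Summit.ValiantsHypothesis.ValiantsHypothesis.Theses.IntegralOrbits.IntDetGlue := by
  intro hNF hLift hHS hEq
  obtain ⟨c₁, hc₁⟩ := exists_qp_hasDetRepr_per hEq
  obtain ⟨c₂, hNF⟩ := hNF
  obtain ⟨c₃, hLift⟩ := hLift
  obtain ⟨c₄, hHS⟩ := hHS
  refine ⟨(c₁ + 2) * c₂ + c₁ + c₂ + c₃ + c₄ + 8, 0, fun n _ => ?_⟩
  obtain ⟨m, hm, hrepr⟩ := hc₁ n
  obtain ⟨m', N, h, M, hm', hN1, hNh, hh, hdet, hspan, hchar⟩ := hNF n m hrepr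
  obtain ⟨e, r, Z, hr, he, hZ, hpencil⟩ :=
    hLift (Fin n × Fin n) m' N h M hN1 hNh hspan hchar
  simp only [map_C_div_eq] at hpencil
  have hQ := det_subst_pencil (fun v : Fin n × Fin n => (X v : MvPolynomial (Fin n × Fin n) ℂ) -
    C (if v.1 = v.2 then (1 : ℂ) else 0)) _ _ r hpencil
  rw [hdet] at hQ
  have hN0 : N ≠ 0 := by omega
  have hNC : (N : ℂ) ≠ 0 := by exact_mod_cast hN0
  have hδ : ∀ v : Fin n × Fin n,
      (((if v.1 = v.2 then (1 : ℤ) else 0 : ℤ)) : ℂ) = if v.1 = v.2 then (1 : ℂ) else 0 := by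
    intro v; split_ifs <;> simp
  have hδ1 : ∀ v : Fin n × Fin n, |(if v.1 = v.2 then (1 : ℤ) else 0 : ℤ)| ≤ 1 := by
    intro v; split_ifs <;> simp
  have hdetB := det_intModel (fun v : Fin n × Fin n => if v.1 = v.2 then (1 : ℤ) else 0)
    (fun v : Fin n × Fin n => if v.1 = v.2 then (1 : ℂ) else 0) hδ Z N e r hNC
    (perPoly (Fin n) ℤ) (by rw [map_perPoly]; exact hQ)
  have hcard : Fintype.card (Fin n × Fin n) = n * n := by simp
  have hcard' : Fintype.card (Fin m' × Fin m') = m' * m' := by simp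
  rw [hcard] at he hZ
  rw [hcard'] at hdetB
  set B := (C ((N : ℤ) ^ e) : MvPolynomial (Fin n × Fin n) ℤ) •
      (1 : Matrix (Fin m' × Fin m') (Fin m' × Fin m') (MvPolynomial (Fin n × Fin n) ℤ)) +
    ∑ v : Fin n × Fin n, ((X v : MvPolynomial (Fin n × Fin n) ℤ) -
      C (if v.1 = v.2 then (1 : ℤ) else 0)) •
        (Z v).map (C : ℤ →+* MvPolynomial (Fin n × Fin n) ℤ) with hB
  set A := Matrix.reindex finProdFinEquiv finProdFinEquiv B with hA
  have hAdeg : ∀ i j, (A i j).totalDegree ≤ 1 := by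
    intro i j
    simp only [hA, Matrix.reindex_apply, Matrix.submatrix_apply, hB]
    exact totalDegree_intModel_le _ _ _ _ _
  have hAcoeff : ∀ i j s, |coeff s (A i j)| ≤ 2 ^ (h * e + (m' + n * n + h + 2) ^ c₃ + n * n + 2) := by
    intro i j s
    simp only [hA, Matrix.reindex_apply, Matrix.submatrix_apply, hB]
    refine (abs_coeff_intModel_le _ hδ1 Z _ _ hZ _ _ s).trans ?_
    rw [hcard, abs_pow, Nat.abs_cast]
    exact_mod_cast height_bound N h e ((m' + n * n + h + 2) ^ c₃) (n * n) hNh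
  have hAdet : A.det = C ((N : ℤ) ^ (e * (m' * m'))) * perPoly (Fin n) ℤ ^ r := by
    rw [hA, Matrix.det_reindex_self, hdetB]
  obtain ⟨m'', B', hm'', hdeg', hcoeff', hdet'⟩ :=
    hHS (Fin n × Fin n) (m' * m') _ _ A hAdeg hAcoeff hAdet
  rw [hcard] at hm''
  refine ⟨m'', r, (N : ℤ) ^ (e * (m' * m')), B', hr, ?_, ?_, hdeg', hcoeff', hdet'⟩
  · exact final_bound c₁ c₂ c₃ c₄ n m m' h e m'' hm hm' hh he hm''
  · exact pow_ne_zero _ (by exact_mod_cast hN0)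

end Summit.ValiantsHypothesis.ValiantsHypothesis.Theorems
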